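import Summits.NavierStokesRegularity.NavierStokesRegularity.Theorems.DssFarFieldSlavingBlowupTypeIDssProfileDoubleConeShellRegular
import Summits.NavierStokesRegularity.NavierStokesRegularity.Theorems.AxisTwistDoorAveragedConeLiouvilleQuantPersistence
import Literature.Analysis.FluidPDE.LocalTypeIProofs
import Literature.Analysis.FluidPDE.NSBoundedHigherRegularityQuantProofs
import Literature.Analysis.FluidPDE.CylindricalCutoff
import HarnessLib

/-!
# A5 input (Lei–Ren–Tian 2025, Thm 1.1), piece P1c: UNIFORM FLAT PARABOLIC SHELLS OF REGULARITY (Lemma 2.4 in the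
# compactness form §4 consumes)

Cell pub/ns-inputs, TABLE A row A5 (`LeiRenTian2025_doubleCone_regularity`), recon memo `kits/A5-recon-ser-b.md` cut P1 /
design point D3; ns-in-lit-a5 g0's key «P1 = ser-b» (STATUS 2026-08-28T19:35:26Z); signature of record
`kits/A5-P1-ShellSig-ser-b-g6.lean` (3b78629ccbc90b66).

Lei–Ren–Tian's Lemma 2.4 (= Lei–Ren 2024, Thm 2 + Rmk 8: "quantitative shells of regularity", `δ ≥ G^{−O(G)}`, bounds
`G^{O(G)}`) is consumed by the proof of their Thm 1.1 ONLY through: a flat parabolic shell `𝒬(a+δ) ∖ 𝒬(a−δ)` of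
regularity exists, with `δ` bounded BELOW and `|v| + |∇v| + |∇²v|` bounded ABOVE by constants depending only on
`G = ∫_{𝒬(1)} (|v|³ + |p|^{3/2}) + 2` — so that one `σ(K, κ)` serves at every scale of the iteration (4.15)–(4.17).  This
file proves exactly that, by compactness, with every engine a theorem of the tree:

* `exists_uniform_flatShell_bound` — for every `K < ∞` there are `δ₀ ∈ (0, 1/20]` and `B` such that every suitable weak
  solution `(u, p)` in Albritton–Barker's class on `Q(0,1)` with `‖u‖_{L³(Q(0,1))} + ‖p‖_{L^{3/2}(Q(0,1))} ≤ K` has a flat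
  parabolic shell `𝒮(a, δ) = 𝒬(a+δ) ∖ cl 𝒬(a−δ)`, `1/3 < a < 2/5`, `δ₀ ≤ δ ≤ 1/20` (`𝒬(r) = SereginSverak2009.parCyl 0 r`;
  scale `a + δ ≤ 9/20` so that `cl 𝒬(9/20) ⊆ Q(0, 9/10)`), with `|u| ≤ B` a.e. on it.  Proof: otherwise a bad sequence
  `(u_n, p_n)` (no shell with `δ ≥ 1/(n+20)` and bound `n`); `SuitableCompactness_holds` gives a limit `(v, q)` in the
  class on `Q(0, 9/10)` with `u_{σ j} → v` in `L³(Q(0, 9/10))`; piece P1b gives a regular flat shell of `v` up to the lid,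
  `1/3 < a − η < a + η < 2/5`, and uniform local bounds `(r₁, M)` below it; `QuantPersistence.quantitative_persistence`
  (26889 programme R2, p637178: Albritton–Barker Prop. 2.3 with explicit radius at every raised vertex) bounds `u_{σ j}`
  by `C/s` a.e. on `𝒮(a, min η 1/20)` for `j ≥ j₀` — contradiction.
* `exists_uniform_flatShell` — the SIGNATURE OF RECORD: the above plus, on every backward cylinder `Q(w′, δ₀/2)` inside the
  shell, a representative with `C^∞` slices whose spatial derivatives of every order are bounded by `D n` and
  `(C n, α n)`-Hölder on `Q(w′, δ₀/4)` (`NSBoundedHigherRegularityBounds_holds`, Seregin–Šverák 2009 §2, with the data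
  `R = δ₀/2`, `M = B`, `P = K^{3/2}` fixed before the solution).

HONEST FRAME / WHAT THIS IS NOT: a compactness RE-PROOF of a PRINTED partial-regularity lemma (qualitative-uniform form of
LRT Lemma 2.4; NOT Lei–Ren's explicit constants — row A11 `LeiRen2024_quantitative_regular_shells_cyl` stays banked); it
serves the INPUT A5; no statement about Navier–Stokes regularity is proved or touched; items 0155 / 15453 and the
summit stay OPEN.  Theorems only (no `def`).  `--supports stmt-NavierStokesRegularity-0155 --as helper`.
[cite: LeiRenTian2025, Lemma 2.4 (arXiv:2501.08976 p. 6) and its use in §4, (4.8)] [cite: LeiRen2024QuantitativeShells,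
Thm 2 + Rmk 8] [cite: AlbrittonBarker2019, Lemma 2.2, Prop. 2.3] [cite: SereginSverak2009, §2 p. 8]
-/

noncomputable section

set_option linter.dupNamespace false

namespace Summit.NavierStokesRegularity.NavierStokesRegularity.Theorems.DoubleCone.Shell

open scoped ENNReal NNReal Topology
open Set Function MeasureTheory Metric Filter TopologicalSpace
open Literature.Analysis.FluidPDE
open Summit.NavierStokesRegularity.NavierStokesRegularity.Theorems.AveragedConeLiouville.QuantPersistence

/-! ### Membership bookkeeping for the open flat parabolic shell `𝒮(a, δ)` -/

/-- A point of the open flat shell `𝒮(a, δ)` (`0 ≤ a − δ`, `δ ≤ η`) lies below the lid, in the box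
`[−(a+δ)², 0] × B̄(0, 2(a+δ))`, and its gauge lies in `[a − η, a + η]`. [folklore] -/
theorem shell_bookkeeping {a δ η : ℝ} (haδ : 0 ≤ a - δ) (hδ : 0 < δ) (hδη : δ ≤ η)
    {y : ℝ × EuclideanSpace ℝ (Fin 3)}
    (hy : y ∈ {w : ℝ × EuclideanSpace ℝ (Fin 3) | w ∈ SereginSverak2009.parCyl 0 (a + δ) ∧
      (w.1 < -(a - δ) ^ 2 ∨ a - δ < cylRadius w.2 ∨ a - δ < |w.2 2|)}) :
    -(a + δ) ^ 2 < y.1 ∧ y.1 < 0 ∧ ‖y.2‖ < 2 * (a + δ) ∧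
      a - η ≤ max (max (cylRadius y.2) |y.2 2|) (Real.sqrt (-y.1)) ∧
      max (max (cylRadius y.2) |y.2 2|) (Real.sqrt (-y.1)) ≤ a + η := by
  obtain ⟨hQ, hor⟩ := hy
  rw [SereginSverak2009.mem_parCyl_zero] at hQ
  obtain ⟨⟨ht1, ht2⟩, hc, hx⟩ := hQ
  have haδ' : 0 < a + δ := by linarith
  refine ⟨ht1, ht2, ?_, ?_, ?_⟩
  · linarith [norm_le_cylRadius_add_abs_apply_two y.2]
  · have hη : a - η ≤ a - δ := by linarith
    rcases hor with h | h | h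
    · exact hη.trans ((le_sqrt_neg_of_le_neg_sq h.le).trans (le_max_right _ _))
    · exact hη.trans (h.le.trans ((le_max_left _ _).trans (le_max_left _ _)))
    · exact hη.trans (h.le.trans ((le_max_right _ _).trans (le_max_left _ _)))
  · have h3 : Real.sqrt (-y.1) ≤ a + δ := (sqrt_neg_lt_of_neg_sq_lt haδ' ht1).le
    refine max_le (max_le (by linarith) (by linarith)) (by linarith)

/-! ### The uniform shell, essential-bound form -/

set_option maxHeartbeats 800000 in
/-- **Uniform flat parabolic shells of regularity, essential-bound form** (Lei–Ren–Tian 2025 Lemma 2.4 in the compactness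
form): for every `K < ∞` there are `δ₀ ∈ (0, 1/20]` and `B ≥ 0` such that every `(u, p)` in Albritton–Barker's class on
`Q(0,1)` with `‖u‖_{L³} + ‖p‖_{L^{3/2}} ≤ K` there has a flat shell `𝒮(a, δ)`, `1/3 < a < 2/5`, `δ₀ ≤ δ ≤ 1/20`, on which
`|u| ≤ B` a.e.  [cite: LeiRenTian2025, Lemma 2.4 (arXiv:2501.08976 p. 6)] [cite: AlbrittonBarker2019, Lemma 2.2, Prop. 2.3] -/
theorem exists_uniform_flatShell_bound :
    ∀ K : ℝ≥0∞, K < ⊤ → ∃ δ₀ B : ℝ, 0 < δ₀ ∧ δ₀ ≤ 1 / 20 ∧ 0 ≤ B ∧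
      ∀ (u : ℝ → EuclideanSpace ℝ (Fin 3) → EuclideanSpace ℝ (Fin 3)) (p : ℝ → EuclideanSpace ℝ (Fin 3) → ℝ),
        IsSuitableWeakSolutionInBall 1 (0 : ℝ × EuclideanSpace ℝ (Fin 3)) u p →
        eLpNorm (uncurry u) 3 (volume.restrict (parabolicCylinder 1 (0 : ℝ × EuclideanSpace ℝ (Fin 3)))) +
          eLpNorm (uncurry p) (3 / 2) (volume.restrict (parabolicCylinder 1 (0 : ℝ × EuclideanSpace ℝ (Fin 3)))) ≤ K →
        ∃ a δ : ℝ, 1 / 3 < a ∧ a < 2 / 5 ∧ δ₀ ≤ δ ∧ δ ≤ 1 / 20 ∧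
          ∀ᵐ w ∂(volume.restrict {w : ℝ × EuclideanSpace ℝ (Fin 3) |
              w ∈ SereginSverak2009.parCyl 0 (a + δ) ∧
              (w.1 < -(a - δ) ^ 2 ∨ a - δ < cylRadius w.2 ∨ a - δ < |w.2 2|)}), ‖u w.1 w.2‖ ≤ B := by
  intro K hK
  by_contra H
  push Not at H
  -- a bad sequence: `(u n, p n)` has NO shell with `δ ≥ 1/(n+20)` and bound `n`
  have H' : ∀ n : ℕ, ∃ (u : ℝ → EuclideanSpace ℝ (Fin 3) → EuclideanSpace ℝ (Fin 3))
      (p : ℝ → EuclideanSpace ℝ (Fin 3) → ℝ),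
      IsSuitableWeakSolutionInBall 1 (0 : ℝ × EuclideanSpace ℝ (Fin 3)) u p ∧
      eLpNorm (uncurry u) 3 (volume.restrict (parabolicCylinder 1 (0 : ℝ × EuclideanSpace ℝ (Fin 3)))) +
        eLpNorm (uncurry p) (3 / 2) (volume.restrict (parabolicCylinder 1 (0 : ℝ × EuclideanSpace ℝ (Fin 3)))) ≤ K ∧
      ∀ a δ : ℝ, 1 / 3 < a → a < 2 / 5 → 1 / ((n : ℝ) + 20) ≤ δ → δ ≤ 1 / 20 →
        ¬ (∀ᵐ w ∂(volume.restrict {w : ℝ × EuclideanSpace ℝ (Fin 3) |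
              w ∈ SereginSverak2009.parCyl 0 (a + δ) ∧
              (w.1 < -(a - δ) ^ 2 ∨ a - δ < cylRadius w.2 ∨ a - δ < |w.2 2|)}), ‖u w.1 w.2‖ ≤ (n : ℝ)) := by
    intro n
    have hδ₀ : (0 : ℝ) < 1 / ((n : ℝ) + 20) := by positivity
    have hδ₀' : 1 / ((n : ℝ) + 20) ≤ 1 / 20 :=
      one_div_le_one_div_of_le (by norm_num) (by linarith [n.cast_nonneg (α := ℝ)])
    obtain ⟨u, p, hu, hKu, hbad⟩ := H _ _ hδ₀ hδ₀' n.cast_nonneg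
    exact ⟨u, p, hu, hKu, fun a δ h1 h2 h3 h4 hall =>
      (hbad a δ h1 h2 h3 h4) (hall.mono fun w hw => not_lt.2 hw)⟩
  choose u p hu hKu hbad using H'
  -- compactness
  set μ₁ : Measure (ℝ × EuclideanSpace ℝ (Fin 3)) :=
    volume.restrict (parabolicCylinder 1 (0 : ℝ × EuclideanSpace ℝ (Fin 3))) with hμ₁
  have hsup : (⨆ k, eLpNorm (uncurry (u k)) 3 μ₁ + eLpNorm (uncurry (p k)) (3 / 2) μ₁) < ∞ :=
    lt_of_le_of_lt (iSup_le fun k => hKu k) hK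
  obtain ⟨v, q, σ, hσ, hlim⟩ := SuitableCompactness_holds u p hu hsup
  have h910 : (9 / 10 : ℝ) ∈ Ioo (0 : ℝ) 1 := ⟨by norm_num, by norm_num⟩
  obtain ⟨hv, -, hconv, -⟩ := hlim (9 / 10) h910
  -- the regular flat shell of the limit, up to the lid (box radius `17/20`, gauge window `(1/3, 2/5)`)
  obtain ⟨a, η, hη, h1, h2, hreg⟩ := exists_regular_gaugeShell hv (ρ₀ := 17 / 20) (by norm_num) (by norm_num)
    (α := 1 / 3) (β := 2 / 5) (by norm_num)
  -- uniform local bounds below the shell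
  obtain ⟨r₁, M, hr₁, hr₁0, hMtop, hbound⟩ := exists_uniform_local_bound hreg (r₀ := 1 / 20) (by norm_num)
  -- quantitative persistence along the subsequence
  have hsupσ : (⨆ k, (eLpNorm (uncurry (u (σ k))) 3 μ₁ + eLpNorm (uncurry (p (σ k))) (3 / 2) μ₁)) < ∞ :=
    lt_of_le_of_lt (iSup_le fun k => hKu (σ k)) hK
  have hKO : parabolicCylinder (9 / 10) (0 : ℝ × EuclideanSpace ℝ (Fin 3)) ⊆
      parabolicCylinder 1 (0 : ℝ × EuclideanSpace ℝ (Fin 3)) := parabolicCylinder_mono (by norm_num) (by norm_num) _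
  obtain ⟨s, C, hs, hsr₁, hC, hev⟩ := quantitative_persistence (v := fun k => u (σ k)) (q := fun k => p (σ k))
    (u := v) (fun k => hu (σ k)) hsupσ hKO hconv hr₁ hMtop
  obtain ⟨k₀, hk₀⟩ := eventually_atTop.1 hev
  -- the shell width
  set δ : ℝ := min η (1 / 20) with hδdef
  have hδ : 0 < δ := lt_min hη (by norm_num)
  have hδη : δ ≤ η := min_le_left _ _
  have hδ20 : δ ≤ 1 / 20 := min_le_right _ _
  have ha1 : 1 / 3 < a := by linarith
  have ha2 : a < 2 / 5 := by linarith
  have haδ : 0 ≤ a - δ := by linarith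
  set S : Set (ℝ × EuclideanSpace ℝ (Fin 3)) := {w : ℝ × EuclideanSpace ℝ (Fin 3) |
      w ∈ SereginSverak2009.parCyl 0 (a + δ) ∧
      (w.1 < -(a - δ) ^ 2 ∨ a - δ < cylRadius w.2 ∨ a - δ < |w.2 2|)} with hSdef
  -- the a.e. bound `C/s` on the shell for `k ≥ k₀`
  have hshell : ∀ k, k₀ ≤ k → ∀ᵐ w ∂(volume.restrict S), ‖u (σ k) w.1 w.2‖ ≤ C / s := by
    intro k hk
    -- the raised vertex above a shell point
    have hrise : ∀ y ∈ S, ∃ h : ℝ, 0 < h ∧ h ≤ -y.1 ∧ h ≤ r₁ ^ 2 ∧ h < s ^ 2 / 4 := by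
      intro y hy
      obtain ⟨-, hy0, -⟩ := shell_bookkeeping haδ hδ hδη hy
      refine ⟨min (-y.1) (min (r₁ ^ 2) (s ^ 2 / 8)), lt_min (by linarith) (lt_min (by positivity) (by positivity)),
        min_le_left _ _, (min_le_right _ _).trans (min_le_left _ _), ?_⟩
      calc min (-y.1) (min (r₁ ^ 2) (s ^ 2 / 8)) ≤ s ^ 2 / 8 := (min_le_right _ _).trans (min_le_right _ _)
        _ < s ^ 2 / 4 := by nlinarith [hs]
    choose! h hh0 hhy hhr hhs using hrise
    set ctr : ℝ × EuclideanSpace ℝ (Fin 3) → ℝ × EuclideanSpace ℝ (Fin 3) := fun y => (y.1 + h y, y.2) with hctr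
    -- the bound on the cylinder `Q(ctr y, s/2)` about each shell point
    have hpt : ∀ y ∈ S, ∀ᵐ w ∂(volume.restrict (parabolicCylinder (s / 2) (ctr y))), ‖u (σ k) w.1 w.2‖ ≤ C / s := by
      intro y hy
      obtain ⟨hy1, hy0, hyx, hg1, hg2⟩ := shell_bookkeeping haδ hδ hδη hy
      have haδ2 : a + δ < 9 / 20 := by linarith
      -- `Q(ctr y, r₁) ⊆ Q(0, 9/10)`
      have hsubK : parabolicCylinder r₁ (ctr y) ⊆ parabolicCylinder (9 / 10) (0 : ℝ × EuclideanSpace ℝ (Fin 3)) := by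
        rintro ⟨τ, ξ⟩ hτ
        rw [mem_parabolicCylinder] at hτ ⊢
        obtain ⟨⟨hτ1, hτ2⟩, hξ⟩ := hτ
        simp only [hctr, Prod.fst_zero, Prod.snd_zero] at hτ1 hτ2 hξ ⊢
        have hr2 : r₁ ^ 2 ≤ (1 / 20) ^ 2 := pow_le_pow_left₀ hr₁.le hr₁0 2
        have haδsq : (a + δ) ^ 2 < (9 / 20) ^ 2 := by nlinarith
        refine ⟨⟨by linarith [hh0 y hy, hy1, hr2, haδsq], by linarith [hhy y hy]⟩, ?_⟩
        rw [dist_zero_right]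
        calc ‖ξ‖ ≤ ‖ξ - y.2‖ + ‖y.2‖ := norm_le_norm_sub_add ξ y.2
          _ < r₁ + 2 * (a + δ) := by rw [← dist_eq_norm]; exact add_lt_add hξ hyx
          _ < 9 / 10 := by linarith
      -- `|v| ≤ M` a.e. on `Q(ctr y, r₁)`
      have hMy : ∀ᵐ w ∂(volume.restrict (parabolicCylinder r₁ (ctr y))), ‖v w.1 w.2‖ₑ ≤ M :=
        hbound y (by nlinarith) hy0 (by linarith) hg1 hg2 (h y) (hh0 y hy) (hhy y hy) (hhr y hy)
      have key := hk₀ k hk (ctr y) hsubK hMy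
      -- from the `L^∞` bound to the pointwise a.e. bound
      have h0 := ae_le_eLpNormEssSup (μ := volume.restrict (parabolicCylinder (s / 2) (ctr y)))
        (f := uncurry (u (σ k)))
      rw [eLpNorm_exponent_top] at key
      filter_upwards [h0] with w hw
      have h3 : ‖uncurry (u (σ k)) w‖ₑ ≤ ENNReal.ofReal (C / s) := hw.trans key
      rw [← ofReal_norm, ENNReal.ofReal_le_ofReal_iff (by positivity)] at h3
      exact h3
    -- every shell point lies in its cylinder; countably many cylinders cover
    have hmem : ∀ y ∈ S, y ∈ parabolicCylinder (s / 2) (ctr y) := by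
      intro y hy
      rw [mem_parabolicCylinder]
      simp only [hctr, dist_self]
      exact ⟨⟨by nlinarith [hhs y hy, hh0 y hy], by linarith [hh0 y hy]⟩, by positivity⟩
    obtain ⟨t, htS, htc, hcover⟩ := TopologicalSpace.countable_cover_nhdsWithin
      (f := fun y => parabolicCylinder (s / 2) (ctr y)) (s := S)
      (fun y hy => mem_nhdsWithin_of_mem_nhds ((isOpen_parabolicCylinder _ _).mem_nhds (hmem y hy)))
    have hunion : ∀ᵐ w ∂(volume.restrict (⋃ y ∈ t, parabolicCylinder (s / 2) (ctr y))),
        ‖u (σ k) w.1 w.2‖ ≤ C / s := by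
      rw [ae_restrict_biUnion_iff _ htc]
      intro y hy
      exact hpt y (htS hy)
    exact ae_restrict_of_ae_restrict_of_subset hcover hunion
  -- the contradiction at a large index
  obtain ⟨N₁, hN₁⟩ := exists_nat_ge (C / s)
  obtain ⟨N₂, hN₂⟩ := exists_nat_ge (1 / δ)
  set k : ℕ := max k₀ (max N₁ N₂) with hkdef
  have hk₀k : k₀ ≤ k := le_max_left _ _
  have hkσ : k ≤ σ k := hσ.id_le k
  have hn1 : C / s ≤ (σ k : ℝ) := by
    calc C / s ≤ (N₁ : ℝ) := hN₁
      _ ≤ (k : ℝ) := by exact_mod_cast (le_max_left _ _).trans (le_max_right k₀ (max N₁ N₂))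
      _ ≤ (σ k : ℝ) := by exact_mod_cast hkσ
  have hn2 : 1 / ((σ k : ℝ) + 20) ≤ δ := by
    have hN₂' : (N₂ : ℝ) ≤ (σ k : ℝ) := by
      exact_mod_cast ((le_max_right _ _).trans (le_max_right k₀ (max N₁ N₂))).trans hkσ
    rw [div_le_iff₀ (by positivity)]
    have := (div_le_iff₀ hδ).1 hN₂
    nlinarith
  refine hbad (σ k) a δ ha1 ha2 hn2 hδ20 ?_
  filter_upwards [hshell k hk₀k] with w hw
  exact hw.trans hn1


/-! ### The signature of record: essential bound + higher derivatives on the shell -/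

/-- The open flat shell `𝒮(a, δ)` with `1/3 < a < 2/5`, `0 < δ ≤ 1/20` lies in the unit parabolic ball `Q(0, 1)`.
[folklore] -/
theorem shell_subset_unitCylinder {a δ : ℝ} (ha1 : 1 / 3 < a) (ha2 : a < 2 / 5) (hδ : 0 < δ) (hδ20 : δ ≤ 1 / 20) :
    {w : ℝ × EuclideanSpace ℝ (Fin 3) | w ∈ SereginSverak2009.parCyl 0 (a + δ) ∧
      (w.1 < -(a - δ) ^ 2 ∨ a - δ < cylRadius w.2 ∨ a - δ < |w.2 2|)} ⊆
      parabolicCylinder 1 (0 : ℝ × EuclideanSpace ℝ (Fin 3)) := by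
  intro y hy
  obtain ⟨hy1, hy0, hyx, -, -⟩ := shell_bookkeeping (η := δ) (by linarith) hδ le_rfl hy
  rw [mem_parabolicCylinder]
  simp only [Prod.fst_zero, Prod.snd_zero, dist_zero_right]
  have : (a + δ) ^ 2 < 1 := by nlinarith
  exact ⟨⟨by linarith, hy0⟩, by linarith⟩

/-- **Uniform flat parabolic shells of regularity** (Lei–Ren–Tian 2025, Lemma 2.4 = Lei–Ren 2024 Thm 2 + Rmk 8, in the
COMPACTNESS form the proof of Thm 1.1 consumes; signature of record `kits/A5-P1-ShellSig-ser-b-g6.lean`).  For every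
`K < ∞` there are `δ₀ ∈ (0, 1/20]`, `B ≥ 0` and sequences `D n`, `C n`, `α n > 0` such that every suitable weak solution
`(u, p)` in Albritton–Barker's class on `Q(0, 1)` with `‖u‖_{L³(Q(0,1))} + ‖p‖_{L^{3/2}(Q(0,1))} ≤ K` admits a flat parabolic
shell `𝒮(a, δ) = 𝒬(a+δ) ∖ cl 𝒬(a−δ)` (`𝒬(r) = SereginSverak2009.parCyl 0 r`; lateral part ∪ `x₃`-caps ∪ initial time
layer), `1/3 < a < 2/5`, `δ₀ ≤ δ ≤ 1/20`, with (i) `|u| ≤ B` a.e. on `𝒮(a, δ)`, and (ii) on every backward cylinder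
`Q(w′, δ₀/2) ⊆ 𝒮(a, δ)` a representative `V` of `u` with `C^∞` slices whose spatial derivatives of order `n` are
`(C n, α n)`-Hölder (sup product metric of `ℝ × ℝ³`) and bounded by `D n` on `Q(w′, δ₀/4)`.  (LRT state `a ∈ (2/3, 4/5)`,
`δ ≤ 1/10` on `𝒬(1)`: zoom by `2`.)
[cite: LeiRenTian2025, Lemma 2.4 (arXiv:2501.08976 p. 6), (4.8) p. 11] [cite: SereginSverak2009, §2 p. 8] -/
theorem exists_uniform_flatShell :
    ∀ K : ℝ≥0∞, K < ⊤ → ∃ δ₀ B : ℝ, 0 < δ₀ ∧ δ₀ ≤ 1 / 20 ∧ 0 ≤ B ∧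
      ∃ (D : ℕ → ℝ) (C α : ℕ → ℝ≥0), (∀ n, 0 < α n) ∧
      ∀ (u : ℝ → EuclideanSpace ℝ (Fin 3) → EuclideanSpace ℝ (Fin 3)) (p : ℝ → EuclideanSpace ℝ (Fin 3) → ℝ),
        IsSuitableWeakSolutionInBall 1 (0 : ℝ × EuclideanSpace ℝ (Fin 3)) u p →
        eLpNorm (uncurry u) 3 (volume.restrict (parabolicCylinder 1 (0 : ℝ × EuclideanSpace ℝ (Fin 3)))) +
          eLpNorm (uncurry p) (3 / 2) (volume.restrict (parabolicCylinder 1 (0 : ℝ × EuclideanSpace ℝ (Fin 3)))) ≤ K →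
        ∃ a δ : ℝ, 1 / 3 < a ∧ a < 2 / 5 ∧ δ₀ ≤ δ ∧ δ ≤ 1 / 20 ∧
          (∀ᵐ w ∂(volume.restrict {w : ℝ × EuclideanSpace ℝ (Fin 3) |
              w ∈ SereginSverak2009.parCyl 0 (a + δ) ∧
              (w.1 < -(a - δ) ^ 2 ∨ a - δ < cylRadius w.2 ∨ a - δ < |w.2 2|)}), ‖u w.1 w.2‖ ≤ B) ∧
          (∀ w' : ℝ × EuclideanSpace ℝ (Fin 3),
            parabolicCylinder (δ₀ / 2) w' ⊆ {w : ℝ × EuclideanSpace ℝ (Fin 3) |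
              w ∈ SereginSverak2009.parCyl 0 (a + δ) ∧
              (w.1 < -(a - δ) ^ 2 ∨ a - δ < cylRadius w.2 ∨ a - δ < |w.2 2|)} →
            ∃ V : ℝ → EuclideanSpace ℝ (Fin 3) → EuclideanSpace ℝ (Fin 3),
              uncurry u =ᵐ[volume.restrict (parabolicCylinder (δ₀ / 2) w')] uncurry V ∧
              (∀ w ∈ parabolicCylinder (δ₀ / 2) w', ContDiffAt ℝ (⊤ : ℕ∞) (V w.1) w.2) ∧
              ∀ n : ℕ,
                HolderOnWith (C n) (α n)
                  (fun w : ℝ × EuclideanSpace ℝ (Fin 3) => iteratedFDeriv ℝ n (V w.1) w.2)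
                  (parabolicCylinder (δ₀ / 4) w') ∧
                ∀ w ∈ parabolicCylinder (δ₀ / 4) w', ‖iteratedFDeriv ℝ n (V w.1) w.2‖ ≤ D n) := by
  intro K hK
  obtain ⟨δ₀, B, hδ₀, hδ₀20, hB, hmain⟩ := exists_uniform_flatShell_bound K hK
  -- the constants of the higher-regularity fact for the data `R = δ₀/2`, `M = B`, `P = K^{3/2}`
  set P : ℝ≥0 := (K ^ (3 / 2 : ℝ)).toNNReal with hP
  have hKP : K ^ (3 / 2 : ℝ) = (P : ℝ≥0∞) := by
    rw [hP, ENNReal.coe_toNNReal (ENNReal.rpow_ne_top_of_nonneg (by norm_num) hK.ne)]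
  obtain ⟨Kf, Cf, αf, hαf, hfact⟩ := NSBoundedHigherRegularityBounds_holds (δ₀ / 2) B P
  have hq : δ₀ / 4 ∈ Ioo 0 (δ₀ / 2) := ⟨by positivity, by linarith⟩
  refine ⟨δ₀, B, hδ₀, hδ₀20, hB, fun n => (Kf n (δ₀ / 4) : ℝ), fun n => Cf n (δ₀ / 4), fun n => αf n (δ₀ / 4),
    fun n => hαf n (δ₀ / 4) hq, fun u p hu hKu => ?_⟩
  obtain ⟨a, δ, ha1, ha2, hδ₀δ, hδ20, hae⟩ := hmain u p hu hKu
  refine ⟨a, δ, ha1, ha2, hδ₀δ, hδ20, hae, fun w' hw' => ?_⟩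
  have hδ : 0 < δ := hδ₀.trans_le hδ₀δ
  have hsub1 : parabolicCylinder (δ₀ / 2) w' ⊆ parabolicCylinder 1 (0 : ℝ × EuclideanSpace ℝ (Fin 3)) :=
    hw'.trans (shell_subset_unitCylinder ha1 ha2 hδ hδ20)
  have hle : parabolicCylinderOpens (δ₀ / 2) w' ≤ parabolicCylinderOpens 1 (0 : ℝ × EuclideanSpace ℝ (Fin 3)) := hsub1
  have hdist : IsDistributionalNSSolutionOn (parabolicCylinderOpens (δ₀ / 2) w') 1 0 u p :=
    (hu.1.of_le hle).distributional
  have hbd : ∀ᵐ w ∂(volume.restrict (parabolicCylinder (δ₀ / 2) w')), ‖u w.1 w.2‖ ≤ B :=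
    ae_restrict_of_ae_restrict_of_subset hw' hae
  have hpr : ∫⁻ w in parabolicCylinder (δ₀ / 2) w', ‖p w.1 w.2‖ₑ ^ (3 / 2 : ℝ) ≤ P := by
    have h1 : eLpNorm (uncurry p) (3 / 2)
        (volume.restrict (parabolicCylinder 1 (0 : ℝ × EuclideanSpace ℝ (Fin 3)))) ≤ K :=
      le_trans le_add_self hKu
    calc ∫⁻ w in parabolicCylinder (δ₀ / 2) w', ‖p w.1 w.2‖ₑ ^ (3 / 2 : ℝ)
        ≤ ∫⁻ w in parabolicCylinder 1 (0 : ℝ × EuclideanSpace ℝ (Fin 3)), ‖p w.1 w.2‖ₑ ^ (3 / 2 : ℝ) :=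
          lintegral_mono_set hsub1
      _ ≤ K ^ (3 / 2 : ℝ) := lintegral_rpow_threeHalves_le_of_eLpNorm_le (f := uncurry p) h1
      _ = P := hKP
  obtain ⟨V, hV, hCD, hH⟩ := hfact u p w' hdist hbd hpr
  refine ⟨V, hV, hCD, fun n => ?_⟩
  obtain ⟨hHol, hbdd⟩ := hH n (δ₀ / 4) hq
  exact ⟨hHol, fun w hw => hbdd w hw⟩

end Summit.NavierStokesRegularity.NavierStokesRegularity.Theorems.DoubleCone.Shell

end
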